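import Summits.QuantumAdvantage.QuantumAdvantage.Theorems.CubicForrelationNearExactIsExactEightSymplectic

/-!
# Crux `CubicForrelation.NearExactIsExact` (stmt-QuantumAdvantage-14043) — SYMPLECTIC EXTRACTION of THREE hyperbolic pairs from a small
  radical, and the sign sum `±8` on the extracted 6-flat

Certificate seat `b2b-cforr-cert` (gen 4).  HONEST FRAMING: elementary finite-field lemmas feeding two-sided theorems about cubic Boolean
functions on 16 bits (the finite slice `n = 16` of the crux) — NOT summit progress.

For a Boolean function `q` of degree `≤ 2` on `𝔽₂ⁿ` with second derivative `B(a,b) = q(0) ⊕ q(a) ⊕ q(b) ⊕ q(a⊕b)` (constant, alternating,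
biadditive: the landed `es_second_deriv`, `es_B_*`), let `R = {a : B(a,·) ≡ 0}` be the RADICAL.
* `ss_gs`: Gram–Schmidt correction of a vector against one hyperbolic pair.
* `ss_extract3`: **if `16·#R < 2ⁿ` there are THREE mutually `B`-orthogonal hyperbolic pairs** `a₀,…,a₅` (`B(a₀,a₁) = B(a₂,a₃) = B(a₄,a₅) = 1`,
  the twelve cross values `0`): a vector outside `R` has a partner by definition of `R`; the next vector is a difference of two points of a
  fibre of `x ↦ (B(x,aᵢ))ᵢ` with more than `#R` points.  (The landed `es_extract` is the bent case — empty radical — with two pairs.)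
* `ss_taylor6`, `ss_flat_signsum6`: on the parametrised 6-flat `x₀ ⊕ ⟨a₀,…,a₅⟩` the function is `q(x₀) ⊕ Σ εᵢDᵢ ⊕ ε₀ε₁ ⊕ ε₂ε₃ ⊕ ε₄ε₅`, whose
  sign sum over the `64` parameters is `±8` (`#ones ∈ {28, 36}` by `decide`).
Consumed by the type-O boundary exclusion on 16 bits: there every parametrised 6-flat sign sum of the quadratic digit must be `≡ 0 (mod 16)`.

References: L. E. Dickson, *Linear Groups* (1901), Ch. VIII; F. J. MacWilliams, N. J. A. Sloane, *The Theory of Error-Correcting Codes* (1977),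
Ch. 15 §2; C. Carlet, *Boolean Functions for Cryptography and Coding Theory*, CUP 2021, §5.2.  Everything below is proved from Mathlib and
the tree; axioms are the standard three.
-/

set_option linter.dupNamespace false -- D-0017: single-problem summit ⇒ `QuantumAdvantage.QuantumAdvantage` by design

noncomputable section

namespace Summit.QuantumAdvantage.QuantumAdvantage.Theorems.CubicForrelation.NearExactIsExact

open Finset
open Literature.Computability.QuantumComplexity
open Literature.Computability.QuantumComplexity.BuzetChailloux (bxor zeroVec bxor_bxor_cancel_left twist_zeroVec_right
  twist_bxor_right bxor_zeroVec zeroVec_bxor bxor_self bxor_comm bxor_eq_zeroVec_iff)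
open Literature.Computability.QuantumComplexity.DerivativeWalsh (W twist_bxor_left)

variable {n : ℕ}

/-! ### Gram–Schmidt against one hyperbolic pair -/

/-- **Gram–Schmidt correction.** For `q` of degree `≤ 2`, a hyperbolic pair `p, p'` (`B(p,p') = 1`) and any `b`, some `b'` is `B`-orthogonal
to `p` and `p'` and has the same `B`-pairing as `b` with every vector orthogonal to `p, p'`. [cite: MacWilliamsSloane1977, Ch. 15 §2] -/
theorem ss_gs (q : (Fin n → Bool) → Bool) (hq : IsDegLeFun 2 q) (p p' b : Fin n → Bool)
    (hpp : (q zeroVec ^^ q p ^^ q p' ^^ q (bxor p p')) = true) :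
    ∃ b' : Fin n → Bool, (q zeroVec ^^ q b' ^^ q p ^^ q (bxor b' p)) = false ∧
      (q zeroVec ^^ q b' ^^ q p' ^^ q (bxor b' p')) = false ∧
      ∀ z, (q zeroVec ^^ q z ^^ q p ^^ q (bxor z p)) = false → (q zeroVec ^^ q z ^^ q p' ^^ q (bxor z p')) = false →
        (q zeroVec ^^ q b' ^^ q z ^^ q (bxor b' z)) = (q zeroVec ^^ q b ^^ q z ^^ q (bxor b z)) := by
  have hsymm := es_B_symm q
  have hadd := es_B_add_left q hq
  have hpp' : (q zeroVec ^^ q p' ^^ q p ^^ q (bxor p' p)) = true := by rw [hsymm]; exact hpp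
  have h00 := es_B_self q p
  have h11 := es_B_self q p'
  cases hβ : (q zeroVec ^^ q b ^^ q p ^^ q (bxor b p)) <;> cases hβ' : (q zeroVec ^^ q b ^^ q p' ^^ q (bxor b p'))
  · exact ⟨b, hβ, hβ', fun z _ _ => rfl⟩
  · -- B(b,p') = 1: correct by p
    refine ⟨bxor b p, ?_, ?_, fun z hz hz' => ?_⟩
    · rw [hadd, hβ, h00]; decide
    · rw [hadd, hβ', hpp]; decide
    · rw [hadd, show (q zeroVec ^^ q p ^^ q z ^^ q (bxor p z)) = false by rw [hsymm]; exact hz, Bool.xor_false]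
  · -- B(b,p) = 1: correct by p'
    refine ⟨bxor b p', ?_, ?_, fun z hz hz' => ?_⟩
    · rw [hadd, hβ, hpp']; decide
    · rw [hadd, hβ', h11]; decide
    · rw [hadd, show (q zeroVec ^^ q p' ^^ q z ^^ q (bxor p' z)) = false by rw [hsymm]; exact hz', Bool.xor_false]
  · -- both: correct by p and p'
    refine ⟨bxor (bxor b p) p', ?_, ?_, fun z hz hz' => ?_⟩
    · rw [hadd, hadd, hβ, h00, hpp']; decide
    · rw [hadd, hadd, hβ', hpp, h11]; decide
    · rw [hadd, hadd, show (q zeroVec ^^ q p ^^ q z ^^ q (bxor p z)) = false by rw [hsymm]; exact hz,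
        show (q zeroVec ^^ q p' ^^ q z ^^ q (bxor p' z)) = false by rw [hsymm]; exact hz', Bool.xor_false, Bool.xor_false]

/-- A difference outside a small set from a large fibre: if `|C|·#R < 2ⁿ` for the value type `C` of a labelling `φ` of `𝔽₂ⁿ`, then two
points of one fibre of `φ` differ by a vector outside `R` (pigeonhole on the fibres, then injectivity of `x' ↦ x ⊕ x'`).  Used with the
labelling by `B`-pairings against already chosen vectors, whose fibres consist of vectors with equal pairings. [folklore] -/
theorem ss_diff_outside {γ : Type*} [Fintype γ] [DecidableEq γ] (R : Finset (Fin n → Bool)) (φ : (Fin n → Bool) → γ)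
    (hcard : Fintype.card γ * #R < 2 ^ n) :
    ∃ x x' : Fin n → Bool, φ x = φ x' ∧ bxor x x' ∉ R := by
  classical
  have hfib : ∃ c : γ, #R < #(univ.filter fun x : Fin n → Bool => φ x = c) := by
    refine Fintype.exists_lt_card_fiber_of_mul_lt_card _ ?_
    rw [Fintype.card_fun, Fintype.card_bool, Fintype.card_fin]
    exact hcard
  obtain ⟨c, hc⟩ := hfib
  obtain ⟨x, hx⟩ : (univ.filter fun x : Fin n → Bool => φ x = c).Nonempty := by
    rw [← card_pos]; omega
  -- the translates `x ⊕ x'`, `x'` in the fibre, are `#fibre > #R` distinct vectors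
  have himg : #R < #((univ.filter fun x' : Fin n → Bool => φ x' = c).image (bxor x)) := by
    rw [card_image_of_injective _ fun a b hab => by simpa only [bxor_bxor_cancel_left] using congrArg (bxor x) hab]
    exact hc
  obtain ⟨t, ht, htR⟩ := exists_mem_notMem_of_card_lt_card himg
  obtain ⟨x', hx', rfl⟩ := mem_image.1 ht
  exact ⟨x, x', (mem_filter.1 hx).2.trans (mem_filter.1 hx').2.symm, htR⟩

/-! ### Three mutually orthogonal hyperbolic pairs from a small radical -/

/-- **Symplectic extraction of three pairs.** For `q` of degree `≤ 2` on `n` bits whose radical `R = {a : ∀ b, B(a,b) = 0}` satisfies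
`16·#R < 2ⁿ`, there are `a₀,…,a₅` with `B(a₀,a₁) = B(a₂,a₃) = B(a₄,a₅) = 1` and all twelve cross values `0`.
[cite: MacWilliamsSloane1977, Ch. 15 §2] -/
theorem ss_extract3 (q : (Fin n → Bool) → Bool) (hq : IsDegLeFun 2 q)
    (hR : 16 * #(univ.filter fun a : Fin n → Bool => ∀ b, (q zeroVec ^^ q a ^^ q b ^^ q (bxor a b)) = false) < 2 ^ n) :
    ∃ a₀ a₁ a₂ a₃ a₄ a₅ : Fin n → Bool,
      (q zeroVec ^^ q a₀ ^^ q a₁ ^^ q (bxor a₀ a₁)) = true ∧ (q zeroVec ^^ q a₂ ^^ q a₃ ^^ q (bxor a₂ a₃)) = true ∧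
      (q zeroVec ^^ q a₄ ^^ q a₅ ^^ q (bxor a₄ a₅)) = true ∧
      (q zeroVec ^^ q a₀ ^^ q a₂ ^^ q (bxor a₀ a₂)) = false ∧ (q zeroVec ^^ q a₀ ^^ q a₃ ^^ q (bxor a₀ a₃)) = false ∧
      (q zeroVec ^^ q a₁ ^^ q a₂ ^^ q (bxor a₁ a₂)) = false ∧ (q zeroVec ^^ q a₁ ^^ q a₃ ^^ q (bxor a₁ a₃)) = false ∧
      (q zeroVec ^^ q a₀ ^^ q a₄ ^^ q (bxor a₀ a₄)) = false ∧ (q zeroVec ^^ q a₀ ^^ q a₅ ^^ q (bxor a₀ a₅)) = false ∧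
      (q zeroVec ^^ q a₁ ^^ q a₄ ^^ q (bxor a₁ a₄)) = false ∧ (q zeroVec ^^ q a₁ ^^ q a₅ ^^ q (bxor a₁ a₅)) = false ∧
      (q zeroVec ^^ q a₂ ^^ q a₄ ^^ q (bxor a₂ a₄)) = false ∧ (q zeroVec ^^ q a₂ ^^ q a₅ ^^ q (bxor a₂ a₅)) = false ∧
      (q zeroVec ^^ q a₃ ^^ q a₄ ^^ q (bxor a₃ a₄)) = false ∧ (q zeroVec ^^ q a₃ ^^ q a₅ ^^ q (bxor a₃ a₅)) = false := by
  classical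
  set R := univ.filter (fun a : Fin n → Bool => ∀ b, (q zeroVec ^^ q a ^^ q b ^^ q (bxor a b)) = false) with hRdef
  have hsymm := es_B_symm q
  have hadd := es_B_add_left q hq
  -- a vector outside `R` has a partner
  have hpartner : ∀ a, a ∉ R → ∃ b, (q zeroVec ^^ q a ^^ q b ^^ q (bxor a b)) = true := by
    intro a ha
    by_contra hno
    push Not at hno
    exact ha (mem_filter.2 ⟨mem_univ _, fun b => by simpa using hno b⟩)
  -- first pair: any `a₀ ∉ R` (a fibre of the constant labelling)
  obtain ⟨x₀, x₀', -, h₀⟩ := ss_diff_outside (γ := Unit) R (fun _ => ()) (by simpa using lt_of_le_of_lt (by omega) hR)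
  set a₀ := bxor x₀ x₀' with ha₀
  obtain ⟨a₁, h01⟩ := hpartner a₀ h₀
  -- second pair: a difference inside a fibre of `x ↦ (B(x,a₀), B(x,a₁))`
  obtain ⟨x₁, x₁', hφ₁, h₂⟩ := ss_diff_outside (γ := Bool × Bool) R
    (fun x => ((q zeroVec ^^ q x ^^ q a₀ ^^ q (bxor x a₀)), (q zeroVec ^^ q x ^^ q a₁ ^^ q (bxor x a₁))))
    (by rw [Fintype.card_prod, Fintype.card_bool]; omega)
  set a₂ := bxor x₁ x₁' with ha₂
  have h20 : (q zeroVec ^^ q a₂ ^^ q a₀ ^^ q (bxor a₂ a₀)) = false := by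
    rw [ha₂, hadd, (Prod.mk.inj hφ₁).1, Bool.xor_self]
  have h21 : (q zeroVec ^^ q a₂ ^^ q a₁ ^^ q (bxor a₂ a₁)) = false := by
    rw [ha₂, hadd, (Prod.mk.inj hφ₁).2, Bool.xor_self]
  obtain ⟨b₂, hb₂⟩ := hpartner a₂ h₂
  obtain ⟨a₃, h30, h31, h3z⟩ := ss_gs q hq a₀ a₁ b₂ h01
  have h23 : (q zeroVec ^^ q a₂ ^^ q a₃ ^^ q (bxor a₂ a₃)) = true := by
    rw [hsymm, h3z a₂ h20 h21, hsymm]; exact hb₂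
  -- third pair: a difference inside a fibre of the four pairings
  obtain ⟨x₂, x₂', hφ₂, h₄⟩ := ss_diff_outside (γ := (Bool × Bool) × (Bool × Bool)) R
    (fun x => (((q zeroVec ^^ q x ^^ q a₀ ^^ q (bxor x a₀)), (q zeroVec ^^ q x ^^ q a₁ ^^ q (bxor x a₁))),
      ((q zeroVec ^^ q x ^^ q a₂ ^^ q (bxor x a₂)), (q zeroVec ^^ q x ^^ q a₃ ^^ q (bxor x a₃)))))
    (by rw [Fintype.card_prod, Fintype.card_prod, Fintype.card_bool]; omega)
  set a₄ := bxor x₂ x₂' with ha₄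
  have h40 : (q zeroVec ^^ q a₄ ^^ q a₀ ^^ q (bxor a₄ a₀)) = false := by
    rw [ha₄, hadd, (Prod.mk.inj (Prod.mk.inj hφ₂).1).1, Bool.xor_self]
  have h41 : (q zeroVec ^^ q a₄ ^^ q a₁ ^^ q (bxor a₄ a₁)) = false := by
    rw [ha₄, hadd, (Prod.mk.inj (Prod.mk.inj hφ₂).1).2, Bool.xor_self]
  have h42 : (q zeroVec ^^ q a₄ ^^ q a₂ ^^ q (bxor a₄ a₂)) = false := by
    rw [ha₄, hadd, (Prod.mk.inj (Prod.mk.inj hφ₂).2).1, Bool.xor_self]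
  have h43 : (q zeroVec ^^ q a₄ ^^ q a₃ ^^ q (bxor a₄ a₃)) = false := by
    rw [ha₄, hadd, (Prod.mk.inj (Prod.mk.inj hφ₂).2).2, Bool.xor_self]
  obtain ⟨b₄, hb₄⟩ := hpartner a₄ h₄
  obtain ⟨b₄', h5'0, h5'1, h5'z⟩ := ss_gs q hq a₀ a₁ b₄ h01
  obtain ⟨a₅, h52, h53, h5z⟩ := ss_gs q hq a₂ a₃ b₄' h23
  have h02 : (q zeroVec ^^ q a₀ ^^ q a₂ ^^ q (bxor a₀ a₂)) = false := by rw [hsymm]; exact h20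
  have h03 : (q zeroVec ^^ q a₀ ^^ q a₃ ^^ q (bxor a₀ a₃)) = false := by rw [hsymm]; exact h30
  have h12 : (q zeroVec ^^ q a₁ ^^ q a₂ ^^ q (bxor a₁ a₂)) = false := by rw [hsymm]; exact h21
  have h13 : (q zeroVec ^^ q a₁ ^^ q a₃ ^^ q (bxor a₁ a₃)) = false := by rw [hsymm]; exact h31
  have h50 : (q zeroVec ^^ q a₅ ^^ q a₀ ^^ q (bxor a₅ a₀)) = false := by rw [h5z a₀ h02 h03]; exact h5'0
  have h51 : (q zeroVec ^^ q a₅ ^^ q a₁ ^^ q (bxor a₅ a₁)) = false := by rw [h5z a₁ h12 h13]; exact h5'1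
  have h45 : (q zeroVec ^^ q a₄ ^^ q a₅ ^^ q (bxor a₄ a₅)) = true := by
    rw [hsymm, h5z a₄ h42 h43, h5'z a₄ h40 h41, hsymm]; exact hb₄
  refine ⟨a₀, a₁, a₂, a₃, a₄, a₅, h01, h23, h45, h02, h03, h12, h13, ?_, ?_, ?_, ?_, ?_, ?_, ?_, ?_⟩
  · rw [hsymm]; exact h40
  · rw [hsymm]; exact h50
  · rw [hsymm]; exact h41
  · rw [hsymm]; exact h51
  · rw [hsymm]; exact h42
  · rw [hsymm]; exact h52
  · rw [hsymm]; exact h43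
  · rw [hsymm]; exact h53

/-! ### The sign sum over the extracted 6-flat is `±8` -/

/-- The parity of a sum of six indicator bits is their xor. [folklore] -/
theorem ss_decide_odd_six (p₀ p₁ p₂ p₃ p₄ p₅ : Bool) :
    decide (Odd ((if p₀ then 1 else 0) + (if p₁ then 1 else 0) + (if p₂ then 1 else 0) + (if p₃ then 1 else 0) +
      (if p₄ then 1 else 0) + (if p₅ then 1 else 0) : ℕ)) = (p₀ ^^ p₁ ^^ p₂ ^^ p₃ ^^ p₄ ^^ p₅) := by
  cases p₀ <;> cases p₁ <;> cases p₂ <;> cases p₃ <;> cases p₄ <;> cases p₅ <;> decide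

/-- The parametrised 6-flat point, explicit xor form. [folklore] -/
theorem ss_flatPt_six (b : Fin n → Bool) (a : Fin 6 → Fin n → Bool) (ε : Fin 6 → Bool) :
    (fun j => b j ^^ decide (Odd #(univ.filter fun i => ε i && a i j))) =
      fun j => b j ^^ ((ε 0 && a 0 j) ^^ (ε 1 && a 1 j) ^^ (ε 2 && a 2 j) ^^ (ε 3 && a 3 j) ^^ (ε 4 && a 4 j) ^^ (ε 5 && a 5 j)) := by
  funext j
  rw [card_filter, Fin.sum_univ_six, ss_decide_odd_six]

/-- The explicit-xor 6-flat point as an iterated `bxor`. [folklore] -/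
theorem ss_flatPt_bxor6 (b a₀ a₁ a₂ a₃ a₄ a₅ : Fin n → Bool) (ε : Fin 6 → Bool) :
    (fun j => b j ^^ ((ε 0 && a₀ j) ^^ (ε 1 && a₁ j) ^^ (ε 2 && a₂ j) ^^ (ε 3 && a₃ j) ^^ (ε 4 && a₄ j) ^^ (ε 5 && a₅ j))) =
      bxor (bxor (bxor (bxor (bxor (bxor b (fun j => ε 0 && a₀ j)) (fun j => ε 1 && a₁ j)) (fun j => ε 2 && a₂ j))
        (fun j => ε 3 && a₃ j)) (fun j => ε 4 && a₄ j)) (fun j => ε 5 && a₅ j) := by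
  funext j
  show _ = ((((((b j ^^ (ε 0 && a₀ j)) ^^ (ε 1 && a₁ j)) ^^ (ε 2 && a₂ j)) ^^ (ε 3 && a₃ j)) ^^ (ε 4 && a₄ j)) ^^ (ε 5 && a₅ j))
  simp only [Bool.xor_assoc]

/-- **Taylor expansion on the extracted 6-flat.** With three mutually orthogonal hyperbolic pairs:
`q(x₀ ⊕ Σ εᵢaᵢ) = q(x₀) ⊕ Σ εᵢ·(q(x₀) ⊕ q(x₀⊕aᵢ)) ⊕ ε₀ε₁ ⊕ ε₂ε₃ ⊕ ε₄ε₅`. [cite: Carlet2020, §5.2] -/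
theorem ss_taylor6 (q : (Fin n → Bool) → Bool) (hq : IsDegLeFun 2 q) (a₀ a₁ a₂ a₃ a₄ a₅ : Fin n → Bool)
    (h01 : (q zeroVec ^^ q a₀ ^^ q a₁ ^^ q (bxor a₀ a₁)) = true) (h23 : (q zeroVec ^^ q a₂ ^^ q a₃ ^^ q (bxor a₂ a₃)) = true)
    (h45 : (q zeroVec ^^ q a₄ ^^ q a₅ ^^ q (bxor a₄ a₅)) = true)
    (h02 : (q zeroVec ^^ q a₀ ^^ q a₂ ^^ q (bxor a₀ a₂)) = false) (h03 : (q zeroVec ^^ q a₀ ^^ q a₃ ^^ q (bxor a₀ a₃)) = false)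
    (h12 : (q zeroVec ^^ q a₁ ^^ q a₂ ^^ q (bxor a₁ a₂)) = false) (h13 : (q zeroVec ^^ q a₁ ^^ q a₃ ^^ q (bxor a₁ a₃)) = false)
    (h04 : (q zeroVec ^^ q a₀ ^^ q a₄ ^^ q (bxor a₀ a₄)) = false) (h05 : (q zeroVec ^^ q a₀ ^^ q a₅ ^^ q (bxor a₀ a₅)) = false)
    (h14 : (q zeroVec ^^ q a₁ ^^ q a₄ ^^ q (bxor a₁ a₄)) = false) (h15 : (q zeroVec ^^ q a₁ ^^ q a₅ ^^ q (bxor a₁ a₅)) = false)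
    (h24 : (q zeroVec ^^ q a₂ ^^ q a₄ ^^ q (bxor a₂ a₄)) = false) (h25 : (q zeroVec ^^ q a₂ ^^ q a₅ ^^ q (bxor a₂ a₅)) = false)
    (h34 : (q zeroVec ^^ q a₃ ^^ q a₄ ^^ q (bxor a₃ a₄)) = false) (h35 : (q zeroVec ^^ q a₃ ^^ q a₅ ^^ q (bxor a₃ a₅)) = false)
    (x₀ : Fin n → Bool) (ε : Fin 6 → Bool) :
    q (fun j => x₀ j ^^ ((ε 0 && a₀ j) ^^ (ε 1 && a₁ j) ^^ (ε 2 && a₂ j) ^^ (ε 3 && a₃ j) ^^ (ε 4 && a₄ j) ^^ (ε 5 && a₅ j))) =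
      (q x₀ ^^ (ε 0 && (q x₀ ^^ q (bxor x₀ a₀))) ^^ (ε 1 && (q x₀ ^^ q (bxor x₀ a₁))) ^^ (ε 0 && ε 1) ^^
        (ε 2 && (q x₀ ^^ q (bxor x₀ a₂))) ^^ (ε 3 && (q x₀ ^^ q (bxor x₀ a₃))) ^^ (ε 2 && ε 3) ^^
        (ε 4 && (q x₀ ^^ q (bxor x₀ a₄))) ^^ (ε 5 && (q x₀ ^^ q (bxor x₀ a₅))) ^^ (ε 4 && ε 5)) := by
  have hsd := es_second_deriv q hq
  rw [ss_flatPt_bxor6]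
  cases h0 : ε 0 <;> cases h1 : ε 1 <;> cases h2 : ε 2 <;> cases h3 : ε 3 <;> cases h4 : ε 4 <;> cases h5 : ε 5 <;>
    simp only [es_bxor_false, hsd, h01, h23, h45, h02, h03, h12, h13, h04, h05, h14, h15, h24, h25, h34, h35,
      Bool.true_and, Bool.false_and, Bool.xor_false, Bool.xor_true] <;>
    generalize q x₀ = A <;> generalize q (bxor x₀ a₀) = A0 <;> generalize q (bxor x₀ a₁) = A1 <;>
    generalize q (bxor x₀ a₂) = A2 <;> generalize q (bxor x₀ a₃) = A3 <;> generalize q (bxor x₀ a₄) = A4 <;>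
    generalize q (bxor x₀ a₅) = A5 <;> revert A A0 A1 A2 A3 A4 A5 <;> decide

/-- The weight of `c ⊕ Σ εᵢdᵢ ⊕ ε₀ε₁ ⊕ ε₂ε₃ ⊕ ε₄ε₅` on `𝔽₂⁶` is `28` or `36` (a bent quadratic on six bits plus an affine function).
[cite: Carlet2020, §5.2] -/
theorem ss_card_bentSix : ∀ (c d₀ d₁ d₂ d₃ d₄ d₅ : Bool),
    #(univ.filter fun ε : Fin 6 → Bool => (c ^^ (ε 0 && d₀) ^^ (ε 1 && d₁) ^^ (ε 0 && ε 1) ^^ (ε 2 && d₂) ^^ (ε 3 && d₃) ^^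
      (ε 2 && ε 3) ^^ (ε 4 && d₄) ^^ (ε 5 && d₅) ^^ (ε 4 && ε 5)) = true) = 28 ∨
    #(univ.filter fun ε : Fin 6 → Bool => (c ^^ (ε 0 && d₀) ^^ (ε 1 && d₁) ^^ (ε 0 && ε 1) ^^ (ε 2 && d₂) ^^ (ε 3 && d₃) ^^
      (ε 2 && ε 3) ^^ (ε 4 && d₄) ^^ (ε 5 && d₅) ^^ (ε 4 && ε 5)) = true) = 36 := by
  decide

/-- **The sign sum over the extracted 6-flat is `±8`.** [this work] -/
theorem ss_flat_signsum6 (q : (Fin n → Bool) → Bool) (hq : IsDegLeFun 2 q) (a₀ a₁ a₂ a₃ a₄ a₅ : Fin n → Bool)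
    (h01 : (q zeroVec ^^ q a₀ ^^ q a₁ ^^ q (bxor a₀ a₁)) = true) (h23 : (q zeroVec ^^ q a₂ ^^ q a₃ ^^ q (bxor a₂ a₃)) = true)
    (h45 : (q zeroVec ^^ q a₄ ^^ q a₅ ^^ q (bxor a₄ a₅)) = true)
    (h02 : (q zeroVec ^^ q a₀ ^^ q a₂ ^^ q (bxor a₀ a₂)) = false) (h03 : (q zeroVec ^^ q a₀ ^^ q a₃ ^^ q (bxor a₀ a₃)) = false)
    (h12 : (q zeroVec ^^ q a₁ ^^ q a₂ ^^ q (bxor a₁ a₂)) = false) (h13 : (q zeroVec ^^ q a₁ ^^ q a₃ ^^ q (bxor a₁ a₃)) = false)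
    (h04 : (q zeroVec ^^ q a₀ ^^ q a₄ ^^ q (bxor a₀ a₄)) = false) (h05 : (q zeroVec ^^ q a₀ ^^ q a₅ ^^ q (bxor a₀ a₅)) = false)
    (h14 : (q zeroVec ^^ q a₁ ^^ q a₄ ^^ q (bxor a₁ a₄)) = false) (h15 : (q zeroVec ^^ q a₁ ^^ q a₅ ^^ q (bxor a₁ a₅)) = false)
    (h24 : (q zeroVec ^^ q a₂ ^^ q a₄ ^^ q (bxor a₂ a₄)) = false) (h25 : (q zeroVec ^^ q a₂ ^^ q a₅ ^^ q (bxor a₂ a₅)) = false)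
    (h34 : (q zeroVec ^^ q a₃ ^^ q a₄ ^^ q (bxor a₃ a₄)) = false) (h35 : (q zeroVec ^^ q a₃ ^^ q a₅ ^^ q (bxor a₃ a₅)) = false)
    (x₀ : Fin n → Bool) :
    ∑ ε : Fin 6 → Bool, signOf (q (fun j => x₀ j ^^ decide (Odd #(univ.filter fun i => ε i && (![a₀, a₁, a₂, a₃, a₄, a₅] i) j)))) = 8 ∨
    ∑ ε : Fin 6 → Bool, signOf (q (fun j => x₀ j ^^ decide (Odd #(univ.filter fun i => ε i && (![a₀, a₁, a₂, a₃, a₄, a₅] i) j)))) = -8 := by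
  have hpt : ∀ ε : Fin 6 → Bool, q (fun j => x₀ j ^^ decide (Odd #(univ.filter fun i => ε i && (![a₀, a₁, a₂, a₃, a₄, a₅] i) j))) =
      (q x₀ ^^ (ε 0 && (q x₀ ^^ q (bxor x₀ a₀))) ^^ (ε 1 && (q x₀ ^^ q (bxor x₀ a₁))) ^^ (ε 0 && ε 1) ^^
        (ε 2 && (q x₀ ^^ q (bxor x₀ a₂))) ^^ (ε 3 && (q x₀ ^^ q (bxor x₀ a₃))) ^^ (ε 2 && ε 3) ^^
        (ε 4 && (q x₀ ^^ q (bxor x₀ a₄))) ^^ (ε 5 && (q x₀ ^^ q (bxor x₀ a₅))) ^^ (ε 4 && ε 5)) := by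
    intro ε
    rw [ss_flatPt_six]
    simp only [Matrix.cons_val_zero, Matrix.cons_val_one]
    rw [show (![a₀, a₁, a₂, a₃, a₄, a₅] : Fin 6 → Fin n → Bool) 2 = a₂ from rfl,
      show (![a₀, a₁, a₂, a₃, a₄, a₅] : Fin 6 → Fin n → Bool) 3 = a₃ from rfl,
      show (![a₀, a₁, a₂, a₃, a₄, a₅] : Fin 6 → Fin n → Bool) 4 = a₄ from rfl,
      show (![a₀, a₁, a₂, a₃, a₄, a₅] : Fin 6 → Fin n → Bool) 5 = a₅ from rfl]
    exact ss_taylor6 q hq a₀ a₁ a₂ a₃ a₄ a₅ h01 h23 h45 h02 h03 h12 h13 h04 h05 h14 h15 h24 h25 h34 h35 x₀ ε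
  simp_rw [hpt]
  rw [fc_sum_signOf_eq_card]
  rcases ss_card_bentSix (q x₀) (q x₀ ^^ q (bxor x₀ a₀)) (q x₀ ^^ q (bxor x₀ a₁)) (q x₀ ^^ q (bxor x₀ a₂))
    (q x₀ ^^ q (bxor x₀ a₃)) (q x₀ ^^ q (bxor x₀ a₄)) (q x₀ ^^ q (bxor x₀ a₅)) with h | h
  · left; rw [h]; norm_num
  · right; rw [h]; norm_num

end Summit.QuantumAdvantage.QuantumAdvantage.Theorems.CubicForrelation.NearExactIsExact

end
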